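import Literature.Computability.AlgebraicComplexity.MS2001ClassVarieties
import Literature.Computability.AlgebraicComplexity.PerStabilizerMarcusMayAllFields
import HarnessLib

/-!
# The `SL`-reading of GCT II Thm. 2.3 ("characterized by its stabilizer") over every field of
# characteristic `0`, and the `W = Sym^d(X)` multiplicity table of GCT I Example 5.2.1

Topic `Literature/Computability/AlgebraicComplexity`; THEOREMS ONLY (no definition, no named fact;
D-0026). Cell `val-lit` (D-0074 GROUP L), seat `val-lit-t01` (row MS2001-A, GCT I §4–§7);
census-neutral companion of `CharacterizedByStabilizerSL.lean` (pub-gct-max, over `ℂ`) and of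
`MS2001Example521.lean` §4 (over `ℂ`).

Mulmuley–Sohoni, GCT II (SIAM J. Comput. 38 (2008)), §1: "`v` is characterized by its stabilizer,
if `V^{G_v̂}`, the set of points in `V` stabilized by `G_v̂`, is equal to `ℂv`", and Thm. 2.3: "both
`perm(X) ∈ P(W)` and `det(Y) ∈ P(V)` are characterized by their stabilizers", with "the natural
action of `G = SL(Y)`" [cite: MulmuleySohoniGCT2SIAM2008, §1 and Thm. 2.3 (arXiv cs/0612134
Thm. 3.3)]; the GCT Introduction, Lecture 13, Prop. [GCT1], says the same with `GL`
[cite: MulmuleySohoniGCTIntro2007, Lecture 13]. The tree decides the literal `G = SL` reading over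
`ℂ` (`CharacterizedByStabilizerSL.lean`): it HOLDS for `det_m` (every `m`), for the padded permanent
`X₀₀^{m−n} per_n` (`n < m`, `m ≥ 3`) and for `per_n` with `n ≢ 1 (mod 4)`, and FAILS for `per_n`,
`n ≡ 1 (mod 4)`, `n ≥ 5` (`det_n ∈ W^{SL_{n²} ∩ Stab(per_n)}`, by the Marcus–May form of the
stabilizer of `per_n` [cite: MarcusMay1962, §2 Theorem, p. 179]).

THIS FILE removes `ℂ`: every statement of `CharacterizedByStabilizerSL.lean` holds, with the same
proof, over EVERY FIELD OF CHARACTERISTIC `0`. The positive halves are restatements for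
`slSubgroup` of the companion file's field-general theorems
`CharacterizedByStabilizer.perPoly_eq_smul_of_fixed_of_det_eq_one` /
`detPoly_eq_smul_of_fixed_of_det_eq_one` / `paddedPerPoly_eq_smul_of_fixed_of_det_eq_one`
(stated there for `[Field k] [CharZero k]`, instantiated at `ℂ` only in `CharacterizedByStabilizerSL`);
the negative half runs the `ℂ` computation verbatim on the Marcus–May sandwich form over a field
of characteristic `0`, `marcusMay1962_perPreserver_sandwich_of_charZero`
(`PerStabilizerMarcusMayAllFields.lean`: the tree's field-general Botta argument; Marcus–May's
printed theorem is over an arbitrary field of characteristic `≠ 2` containing enough elements).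

PROVED here, for every field `F` of characteristic `0`:

* `linSubstRep_detPoly_eq_of_det_eq_one_of_perPoly_of_charZero` — `n ≥ 3`, `n ≡ 1 (mod 4)`: every
  `γ ∈ GL_{n²}(F)` with `det γ = 1` fixing `per_n` fixes `det_n`;
  `detPoly_mem_fixedForms_slSubgroup_perPoly_of_charZero`,
  `span_pair_le_fixedForms_slSubgroup_perPoly_of_charZero`;
* `not_isCharacterizedByStabilizerIn_slSubgroup_perPoly_of_charZero` (`n ≥ 5`, `n ≡ 1 (mod 4)`),
  `isCharacterizedByStabilizerIn_slSubgroup_perPoly_of_charZero` (`n ≢ 1 (mod 4)`),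
  `isCharacterizedByStabilizerIn_slSubgroup_perPoly_iff_of_charZero` (`n ≥ 2`: iff `n ≢ 1 (mod 4)`),
  `fixedForms_slSubgroup_perPoly_eq_of_charZero` (`= F · per_n`, `n ≢ 1 (mod 4)`);
* `fixedForms_slSubgroup_detPoly_eq_of_charZero` (every `m`; the statement
  `IsCharacterizedByStabilizerIn (slSubgroup _ F) det_m m` itself is already the tree's
  `MS2001_prop_4_2_of_charZero`, `MS2001ClassVarieties.lean` — GCT I Prop. 4.2 in characteristic `0`);
  `isCharacterizedByStabilizerIn_slSubgroup_paddedPerPoly_of_charZero`,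
  `fixedForms_slSubgroup_paddedPerPoly_eq_of_charZero` (`n < m`, `m ≥ 3`);
* the `W = Sym^d(X)` (`a = 1`) line of the multiplicity table of GCT I, Example 5.2.1
  [cite: MulmuleySohoniSIAM2001, §5.2.1 Example 1 (AV pp. 21–22)] over `F`:
  `finrank_fixedForms_slSubgroup_detPoly_self_of_charZero` (`dim (Sym^d)^Q = 1`, `Q = SL ∩ Stab det_d`),
  `finrank_fixedForms_slSubgroup_perPoly_self_of_mod_four_ne_one_of_charZero` (`dim (Sym^d)^H = 1`,
  `d ≢ 1 (mod 4)`), `two_le_finrank_fixedForms_slSubgroup_perPoly_self_of_mod_four_eq_one_of_charZero`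
  (`≥ 2`, `d ≡ 1 (mod 4)`, `d ≥ 5`), and `MS2001_example_5_2_1_degree_self_iff_of_charZero` (`d ≥ 2`:
  `dim (Sym^d)^Q < dim (Sym^d)^H ↔ d ≡ 1 (mod 4)` — in degree `d` itself the multiplicity criterion
  of GCT I Thm. 5.1 for `(per_d, det_d)` applies exactly in the residue `d ≡ 1 (mod 4)`; MS's own
  obstructions are `Sym^{ad}`, `a > 1`, tree `MS2001Example521.lean`).

Honest framing: no new mathematics beyond field-generality — the erratum to the literal
`SL`-reading of GCT II Thm. 2.3 and its exact residue statement are now recorded over every field of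
characteristic `0` (so in particular over `ℚ`, `ℝ`, `\overline{ℚ}`), as is the `a = 1` line of the
Example 5.2.1 table. The `GL`-reading of Thm. 2.3 (`perPoly_isCharacterizedByStabilizer_holds`) is
unaffected. Nothing here bears on VP versus VNP.

## References

* [MulmuleySohoniGCT2SIAM2008] K. D. Mulmuley, M. Sohoni, *Geometric complexity theory II*,
  SIAM J. Comput. 38 (2008) 1175–1206, §1 (definition), Thm. 2.3 (= arXiv cs/0612134 Thm. 3.3).
* [MulmuleySohoniGCTIntro2007] K. D. Mulmuley, M. Sohoni, *GCT: Introduction*, arXiv:0709.0746,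
  Lecture 13, Prop. [GCT1].
* [MarcusMay1962] M. Marcus, F. C. May, *The permanent function*, Canad. J. Math. 14 (1962)
  177–189, §2 Theorem, p. 179.
* [MulmuleySohoniSIAM2001] K. D. Mulmuley, M. Sohoni, *Geometric complexity theory I*, SIAM J.
  Comput. 31 (2001) 496–526, §5.2.1 Example 1 (AV pp. 21–22).

## Design

`namespace Literature.Computability.AlgebraicComplexity`; the index-permutation and sandwich
helpers of `CharacterizedByStabilizerSL` are `private` there and are repeated here (`private`,
primed names) in `namespace CharacterizedByStabilizerSLAllFields`. Field universe `Type*`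
(as `CharacterizedByStabilizer.lean`, `PerStabilizerMarcusMayAllFields.lean`). Standard axioms only.
-/

noncomputable section

open MvPolynomial Matrix

namespace Literature.Computability.AlgebraicComplexity

namespace CharacterizedByStabilizerSLAllFields

open CharacterizedByStabilizerSL

variable {n : ℕ}

/-! ## Index permutations of a monomial sandwich and their signs (copies) -/

/-- `sandwichPerm π ρ (a, b) = (π a, ρ⁻¹ b)`. [folklore] -/
private theorem sandwichPerm_apply' (π ρ : Equiv.Perm (Fin n)) (p : Fin n × Fin n) :
    sandwichPerm π ρ p = (π p.1, ρ.symm p.2) := by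
  rcases p with ⟨a, b⟩
  simp [sandwichPerm, Equiv.Perm.mul_apply]

/-- `sgn` of `(a, b) ↦ (π a, ρ⁻¹ b)` is `sgn π · sgn ρ` for odd `n`. [folklore] -/
private theorem sign_sandwichPerm' (hn : Odd n) (π ρ : Equiv.Perm (Fin n)) :
    Equiv.Perm.sign (sandwichPerm π ρ) = Equiv.Perm.sign π * Equiv.Perm.sign ρ := by
  unfold sandwichPerm
  rw [map_mul, Equiv.Perm.sign_prodCongrLeft, Equiv.Perm.sign_prodCongrRight, Finset.prod_const,
    Finset.prod_const, Finset.card_univ, Fintype.card_fin, Equiv.Perm.sign_symm,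
    Int.units_pow_eq_pow_mod_two (Equiv.Perm.sign π) n,
    Int.units_pow_eq_pow_mod_two (Equiv.Perm.sign ρ) n, Nat.odd_iff.mp hn, pow_one, pow_one]

/-- `swapPerm n (a, b) = (b, a)`. [folklore] -/
private theorem swapPerm_apply' (p : Fin n × Fin n) : swapPerm n p = (p.2, p.1) := rfl

/-- For `n ≡ 1 (mod 4)` the index swap is an even permutation of the `n²` positions. [folklore] -/
private theorem sign_swapPerm_of_mod_four_eq_one' (h1 : n % 4 = 1) :
    Equiv.Perm.sign (swapPerm n) = 1 := by
  have hsq : swapPerm n ^ 2 = 1 := by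
    ext p <;> simp [pow_two, Equiv.Perm.mul_apply]
  have hfp : Fintype.card (Function.fixedPoints (swapPerm n)) = n := by
    let e : Function.fixedPoints (swapPerm n) ≃ Fin n :=
      { toFun := fun p => p.1.1
        invFun := fun i => ⟨(i, i), Function.mem_fixedPoints_iff.mpr rfl⟩
        left_inv := by
          rintro ⟨⟨a, b⟩, hp⟩
          have hba : b = a := by
            have := congrArg Prod.fst (Function.mem_fixedPoints_iff.mp hp)
            simpa [swapPerm_apply'] using this
          subst hba
          rfl
        right_inv := fun i => rfl }
    simpa using Fintype.card_congr e
  obtain ⟨q, hq⟩ : ∃ q, n = 4 * q + 1 := ⟨n / 4, by omega⟩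
  have hsub : n * n - n = 2 * (2 * (q * (4 * q + 1))) := by
    subst hq
    apply Nat.sub_eq_of_eq_add
    ring
  have hdiv : (Fintype.card (Fin n × Fin n) -
      Fintype.card (Function.fixedPoints (swapPerm n))) / 2 = 2 * (q * (4 * q + 1)) := by
    rw [hfp, Fintype.card_prod, Fintype.card_fin, hsub, Nat.mul_div_cancel_left _ two_pos]
  rw [Equiv.Perm.sign_of_pow_two_eq_one hsq, hdiv, pow_mul, Int.units_sq, one_pow]

/-! ## Entries and determinant of a monomial sandwich (copies, any commutative ring) -/

/-- `(D P_π X P_ρ L)_{ab} = d_a · X_{π a, ρ⁻¹ b} · l_b`. [folklore] -/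
private theorem sandwich_apply' {ι R : Type*} [Fintype ι] [DecidableEq ι] [CommRing R]
    (d l : ι → R) (π ρ : Equiv.Perm ι) (X : Matrix ι ι R) (a b : ι) :
    (diagonal d * π.permMatrix R * X * ρ.permMatrix R * diagonal l) a b =
      d a * X (π a) (ρ.symm b) * l b := by
  rw [Matrix.mul_diagonal, PEquiv.mul_toMatrix_toPEquiv, Matrix.submatrix_apply, id,
    Matrix.mul_assoc, Matrix.diagonal_mul, PEquiv.toMatrix_toPEquiv_mul, Matrix.submatrix_apply, id]

/-- If `(Mᵀ v)_p = w_p · v_{θ p}` then `det M = (∏ w) · sgn θ`. [folklore] -/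
private theorem det_eq_of_transpose_mulVec' {τ R : Type*} [Fintype τ] [DecidableEq τ] [CommRing R]
    (M : Matrix τ τ R) (w : τ → R) (θ : Equiv.Perm τ)
    (h : ∀ (v : τ → R) (p : τ), (Mᵀ *ᵥ v) p = w p * v (θ p)) :
    M.det = (∏ p, w p) * (((Equiv.Perm.sign θ : ℤˣ) : ℤ) : R) := by
  have hM : Mᵀ = diagonal w * θ.permMatrix R := by
    refine Matrix.toLin'.injective (LinearMap.ext fun v => ?_)
    rw [Matrix.toLin'_apply, Matrix.toLin'_apply, ← Matrix.mulVec_mulVec, Matrix.permMatrix_mulVec]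
    funext p
    rw [h v p, Matrix.mulVec_diagonal, Function.comp_apply]
  rw [← Matrix.det_transpose, hM, Matrix.det_mul, Matrix.det_diagonal, Matrix.det_permutation]

/-- `∏_{(a,b)} d_a l_b = ((∏ d)(∏ l))^n = 1` under the Marcus–May normalisation. [folklore] -/
private theorem prod_weights_eq_one' {R : Type*} [CommRing R] {d l : Fin n → R}
    (hdl : (∏ i, d i) * (∏ i, l i) = 1) : (∏ p : Fin n × Fin n, d p.1 * l p.2) = 1 := by
  rw [Fintype.prod_prod_type]
  simp only [Finset.prod_mul_distrib, Finset.prod_const, Finset.card_univ, Fintype.card_fin,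
    Finset.prod_pow]
  rw [← mul_pow, hdl, one_pow]

/-- `(M · f)(x) = f(Mᵀ x)`. [folklore] -/
private theorem eval_linSubst' {σ R : Type*} [Fintype σ] [CommRing R] (M : Matrix σ σ R)
    (x : σ → R) (f : MvPolynomial σ R) : eval x (linSubst σ R M f) = eval (Mᵀ *ᵥ x) f := by
  induction f using MvPolynomial.induction_on with
  | C a => rw [linSubst_C, eval_C, eval_C]
  | add p q hp hq => rw [map_add, map_add, map_add, hp, hq]
  | mul_X p i hp =>
    rw [map_mul, map_mul, map_mul, hp, linSubst_X, eval_X]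
    congr 1
    simp [Matrix.mulVec, dotProduct, smul_eval]

/-- `det_n ≠ c · per_n` for `n ≥ 2` over a field of characteristic `0` (evaluate at `1` and at a
transposition matrix). [folklore] -/
private theorem detPoly_ne_smul_perPoly' {F : Type*} [Field F] [CharZero F] (h2 : 2 ≤ n) (c : F) :
    detPoly (Fin n) F ≠ c • perPoly (Fin n) F := by
  intro h
  have hev : ∀ A : Matrix (Fin n) (Fin n) F, A.det = c * A.permanent := by
    intro A
    have hA : (Matrix.of fun i j : Fin n => A i j) = A := Matrix.ext fun _ _ => rfl
    have := congrArg (eval fun p : Fin n × Fin n => A p.1 p.2) h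
    rw [smul_eval, eval_detPoly, eval_perPoly] at this
    simpa only [hA] using this
  have hc1 : c = 1 := by
    have := hev 1
    rw [Matrix.det_one, Matrix.permanent_one, mul_one] at this
    exact this.symm
  set a : Fin n := ⟨0, by omega⟩
  set b : Fin n := ⟨1, by omega⟩
  have hab : a ≠ b := by simp [a, b, Fin.ext_iff]
  have h₂ := hev ((Equiv.swap a b).permMatrix F)
  rw [Matrix.det_permutation, Equiv.Perm.sign_swap hab, ← Matrix.mul_one
      ((Equiv.swap a b).permMatrix F), MarcusMay.permanent_permMatrix_mul, Matrix.permanent_one,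
    mul_one, hc1] at h₂
  norm_num at h₂

/-- `det_d ≠ 0` over a field (Mathlib `Matrix.det_mvPolynomialX_ne_zero`). [folklore] -/
private theorem detPoly_ne_zero' (d : ℕ) (F : Type*) [Field F] : detPoly (Fin d) F ≠ 0 :=
  Matrix.det_mvPolynomialX_ne_zero (Fin d) F

/-- `per_d ≠ 0` over a field (it evaluates to `per 1 = 1` at the identity matrix; the tree's
`perPoly_ne_zero` of `StandardFamiliesProofs`, repeated to keep imports small). [folklore] -/
private theorem perPoly_ne_zero' (d : ℕ) (F : Type*) [Field F] : perPoly (Fin d) F ≠ 0 := by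
  intro h
  have h1 := congrArg (eval fun p : Fin d × Fin d => (1 : Matrix (Fin d) (Fin d) F) p.1 p.2) h
  have hA : (Matrix.of fun i j : Fin d => (1 : Matrix (Fin d) (Fin d) F) i j) = 1 :=
    Matrix.ext fun _ _ => rfl
  rw [eval_perPoly, hA, Matrix.permanent_one, map_zero] at h1
  exact one_ne_zero h1

/-- `Sym^d` is finite-dimensional (Mathlib `homogeneousSubmodule_fg`). [folklore] -/
private theorem finite_homogeneousSubmodule' (τ : Type*) [Finite τ] (R : Type*) [CommSemiring R]
    (d : ℕ) : Module.Finite R (homogeneousSubmodule τ R d) :=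
  Module.Finite.iff_fg.mpr (homogeneousSubmodule_fg τ R d)

/-- `per_d` and `det_d` are linearly independent for `d ≥ 2` over a field of characteristic `0`
(evaluate at `1`: `s + t = 0`; at a transposition matrix: `s − t = 0`). [folklore] -/
private theorem linearIndependent_perPoly_detPoly' {F : Type*} [Field F] [CharZero F] {d : ℕ}
    (hd : 2 ≤ d) : LinearIndependent F ![perPoly (Fin d) F, detPoly (Fin d) F] := by
  rw [LinearIndependent.pair_iff]
  intro s t hst
  have hev : ∀ A : Matrix (Fin d) (Fin d) F, s * A.permanent + t * A.det = 0 := by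
    intro A
    have hA : (Matrix.of fun i j : Fin d => A i j) = A := Matrix.ext fun _ _ => rfl
    have := congrArg (eval fun p : Fin d × Fin d => A p.1 p.2) hst
    rw [map_add, smul_eval, smul_eval, eval_detPoly, eval_perPoly, map_zero] at this
    simpa only [hA] using this
  have h1 := hev 1
  rw [Matrix.det_one, Matrix.permanent_one, mul_one, mul_one] at h1
  set a : Fin d := ⟨0, by omega⟩
  set b : Fin d := ⟨1, by omega⟩
  have hab : a ≠ b := by simp [a, b, Fin.ext_iff]
  have h₂ := hev ((Equiv.swap a b).permMatrix F)
  rw [Matrix.det_permutation, Equiv.Perm.sign_swap hab, ← Matrix.mul_one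
      ((Equiv.swap a b).permMatrix F), MarcusMay.permanent_permMatrix_mul, Matrix.permanent_one,
    mul_one] at h₂
  norm_num at h₂
  have hs : s = 0 := by linear_combination (h1 + h₂) / 2
  refine ⟨hs, ?_⟩
  rw [hs, zero_add] at h1
  exact h1

end CharacterizedByStabilizerSLAllFields

open CharacterizedByStabilizerSL CharacterizedByStabilizerSLAllFields

variable {n : ℕ}

/-! ## The stabilizer of `per_n` inside `SL_{n²}(F)` fixes `det_n` when `n ≡ 1 (mod 4)` -/

/-- **Main lemma, every field of characteristic `0`.** For `n ≥ 3`, `n ≡ 1 (mod 4)`: an invertible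
linear substitution of determinant `1` that fixes `per_n` fixes `det_n` (Marcus–May sandwich form
over `F`, `marcusMay1962_perPreserver_sandwich_of_charZero`; `det`-multiplier `sgn π sgn ρ`;
`det γ = sgn π sgn ρ (−1)^{[T] n(n−1)/2}`). The `ℂ` case is
`CharacterizedByStabilizerSL.linSubstRep_detPoly_eq_of_det_eq_one_of_perPoly`; same computation.
[cite: MarcusMay1962, §2 Theorem, p. 179] (the stabilizer; the conclusion is the tree's own
elementary computation) -/
theorem linSubstRep_detPoly_eq_of_det_eq_one_of_perPoly_of_charZero (F : Type*) [Field F]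
    [CharZero F] (h3 : 3 ≤ n) (h1 : n % 4 = 1) {γ : GL (Fin n × Fin n) F}
    (hdet : Matrix.det (γ : Matrix (Fin n × Fin n) (Fin n × Fin n) F) = 1)
    (hper : linSubstRep (Fin n × Fin n) F γ (perPoly (Fin n) F) = perPoly (Fin n) F) :
    linSubstRep (Fin n × Fin n) F γ (detPoly (Fin n) F) = detPoly (Fin n) F := by
  haveI : Infinite F := Infinite.of_injective _ Nat.cast_injective
  obtain ⟨π, ρ, d, l, hdl, hcase⟩ := marcusMay1962_perPreserver_sandwich_of_charZero F h3
    ((mem_linStabilizer (f := perPoly (Fin n) F)).mpr hper)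
  have hodd : Odd n := Nat.odd_iff.mpr (by omega)
  -- the scalar by which `γ` multiplies `det_n`
  set ε : F := (((Equiv.Perm.sign π : ℤˣ) : ℤ) : F) * (((Equiv.Perm.sign ρ : ℤˣ) : ℤ) : F)
    with hε
  -- (1) `γ · det = ε det`, pointwise
  have key : ∀ x : Fin n × Fin n → F,
      eval x (linSubst (Fin n × Fin n) F (γ : Matrix (Fin n × Fin n) (Fin n × Fin n) F)
        (detPoly (Fin n) F)) = ε * eval x (detPoly (Fin n) F) := by
    intro x
    rw [eval_linSubst', eval_detPoly, eval_detPoly]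
    rcases hcase with hM | hM
    · rw [hM x]
      simp only [Matrix.det_mul, Matrix.det_diagonal, Matrix.det_permutation, hε]
      linear_combination ((((Equiv.Perm.sign π : ℤˣ) : ℤ) : F) *
        (((Equiv.Perm.sign ρ : ℤˣ) : ℤ) : F) * (Matrix.of fun a b => x (a, b)).det) * hdl
    · rw [hM x]
      simp only [Matrix.det_mul, Matrix.det_diagonal, Matrix.det_permutation, Matrix.det_transpose,
        hε]
      linear_combination ((((Equiv.Perm.sign π : ℤˣ) : ℤ) : F) *
        (((Equiv.Perm.sign ρ : ℤˣ) : ℤ) : F) * (Matrix.of fun a b => x (a, b)).det) * hdl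
  -- (2) `det γ = ε · [sgn swap]`, hence `ε = 1`
  have hε1 : ε = 1 := by
    rcases hcase with hM | hM
    · have hact : ∀ (v : Fin n × Fin n → F) (p : Fin n × Fin n),
          ((γ : Matrix (Fin n × Fin n) (Fin n × Fin n) F)ᵀ *ᵥ v) p =
            (d p.1 * l p.2) * v (sandwichPerm π ρ p) := by
        rintro v ⟨a, b⟩
        have := congr_fun (congr_fun (hM v) a) b
        rw [sandwich_apply'] at this
        simp only [Matrix.of_apply] at this
        rw [this, sandwichPerm_apply']
        dsimp only
        ring
      have hd := det_eq_of_transpose_mulVec' _ _ _ hact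
      rw [hdet, prod_weights_eq_one' hdl, one_mul, sign_sandwichPerm' hodd, Units.val_mul,
        Int.cast_mul] at hd
      rw [hε, ← hd]
    · have hact : ∀ (v : Fin n × Fin n → F) (p : Fin n × Fin n),
          ((γ : Matrix (Fin n × Fin n) (Fin n × Fin n) F)ᵀ *ᵥ v) p =
            (d p.1 * l p.2) * v ((swapPerm n * sandwichPerm π ρ) p) := by
        rintro v ⟨a, b⟩
        have := congr_fun (congr_fun (hM v) a) b
        rw [sandwich_apply'] at this
        simp only [Matrix.of_apply, Matrix.transpose_apply] at this
        rw [this, Equiv.Perm.mul_apply, sandwichPerm_apply', swapPerm_apply']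
        dsimp only
        ring
      have hd := det_eq_of_transpose_mulVec' _ _ _ hact
      rw [hdet, prod_weights_eq_one' hdl, one_mul, map_mul, sign_swapPerm_of_mod_four_eq_one' h1,
        one_mul, sign_sandwichPerm' hodd, Units.val_mul, Int.cast_mul] at hd
      rw [hε, ← hd]
  -- (3) conclude by the identity of polynomial functions (`F` infinite)
  apply MvPolynomial.funext
  intro x
  rw [linSubstRep_apply, key x, hε1, one_mul]

/-- **`det_n ∈ W^{SL_{n²}(F) ∩ Stab(per_n)}`** for `n ≥ 3`, `n ≡ 1 (mod 4)`, every field `F` of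
characteristic `0`. [cite: MarcusMay1962, §2 Theorem, p. 179] (own computation from the stabilizer)
[cite: MulmuleySohoniGCT2SIAM2008, §1 (definition of `V^{G_v̂}`)] -/
theorem detPoly_mem_fixedForms_slSubgroup_perPoly_of_charZero (F : Type*) [Field F] [CharZero F]
    (h3 : 3 ≤ n) (h1 : n % 4 = 1) :
    detPoly (Fin n) F ∈ fixedForms (slSubgroup (Fin n × Fin n) F) (perPoly (Fin n) F) n := by
  refine mem_fixedForms_iff.mpr ⟨by simpa using detPoly_isHomogeneous (n := Fin n) (k := F), ?_⟩
  intro γ hγ hper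
  exact linSubstRep_detPoly_eq_of_det_eq_one_of_perPoly_of_charZero F h3 h1
    (mem_slSubgroup_iff.mp hγ) hper

/-- `⟨per_n, det_n⟩_F ⊆ W^{SL_{n²}(F) ∩ Stab(per_n)}` (`n ≥ 3`, `n ≡ 1 (mod 4)`, characteristic `0`).
[cite: MarcusMay1962, §2 Theorem, p. 179] [cite: MulmuleySohoniGCT2SIAM2008, §1 (definition of `V^{G_v̂}`)] -/
theorem span_pair_le_fixedForms_slSubgroup_perPoly_of_charZero (F : Type*) [Field F] [CharZero F]
    (h3 : 3 ≤ n) (h1 : n % 4 = 1) :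
    Submodule.span F {perPoly (Fin n) F, detPoly (Fin n) F} ≤
      fixedForms (slSubgroup (Fin n × Fin n) F) (perPoly (Fin n) F) n := by
  rw [Submodule.span_le]
  rintro p (rfl | rfl)
  · exact mem_fixedForms_iff.mpr
      ⟨by simpa using perPoly_isHomogeneous (n := Fin n) (k := F), fun _ _ h => h⟩
  · exact detPoly_mem_fixedForms_slSubgroup_perPoly_of_charZero F h3 h1

/-- **The `SL(X)`-reading of GCT II Thm. 2.3 for the permanent fails for `n ≡ 1 (mod 4)`, `n ≥ 5`,
over every field of characteristic `0`:** `per_n` is not characterized by its stabilizer in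
`SL_{n²}(F)` in the sense of Mulmuley–Sohoni 2008 §1. (`ℂ`: `not_isCharacterizedByStabilizerIn_slSubgroup_perPoly`.)
[cite: MulmuleySohoniGCT2SIAM2008, §1 (definition) and Thm. 2.3 (the statement refuted in this reading)]
(refutation: own computation from [cite: MarcusMay1962, §2 Theorem, p. 179]) -/
theorem not_isCharacterizedByStabilizerIn_slSubgroup_perPoly_of_charZero (F : Type*) [Field F]
    [CharZero F] (h5 : 5 ≤ n) (h1 : n % 4 = 1) :
    ¬ IsCharacterizedByStabilizerIn (slSubgroup (Fin n × Fin n) F) (perPoly (Fin n) F) n := by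
  intro h
  obtain ⟨c, hc⟩ := h (detPoly (Fin n) F)
    (by simpa using detPoly_isHomogeneous (n := Fin n) (k := F))
    (fun γ hγ hper => linSubstRep_detPoly_eq_of_det_eq_one_of_perPoly_of_charZero F (by omega) h1
      (mem_slSubgroup_iff.mp hγ) hper)
  exact detPoly_ne_smul_perPoly' (by omega) c hc

/-- In particular for `n = 5` over `ℚ` (`perm₅`, `SL₂₅(ℚ)`). [folklore] -/
example : ¬ IsCharacterizedByStabilizerIn (slSubgroup (Fin 5 × Fin 5) ℚ) (perPoly (Fin 5) ℚ) 5 :=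
  not_isCharacterizedByStabilizerIn_slSubgroup_perPoly_of_charZero ℚ le_rfl rfl

/-! ## The positive half and the exact statement over `F` -/

/-- **For `n ≢ 1 (mod 4)`, `per_n` IS characterized by its stabilizer in `SL_{n²}(F)`**, every field
`F` of characteristic `0`: restatement for `slSubgroup` of
`CharacterizedByStabilizer.perPoly_eq_smul_of_fixed_of_det_eq_one`.
[cite: MulmuleySohoniGCT2SIAM2008, §1 (definition) and Thm. 2.3 (arXiv cs/0612134 Thm. 3.3)] -/
theorem isCharacterizedByStabilizerIn_slSubgroup_perPoly_of_charZero (F : Type*) [Field F]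
    [CharZero F] (hn : n % 4 ≠ 1) :
    IsCharacterizedByStabilizerIn (slSubgroup (Fin n × Fin n) F) (perPoly (Fin n) F) n :=
  fun p hp hfix => CharacterizedByStabilizer.perPoly_eq_smul_of_fixed_of_det_eq_one hn p hp
    fun γ hdet hper => hfix γ (mem_slSubgroup_iff.mpr hdet) hper

/-- `W^{SL_{n²}(F) ∩ Stab(per_n)} = F · per_n` for `n ≢ 1 (mod 4)`, characteristic `0`.
[cite: MulmuleySohoniGCT2SIAM2008, §1 (definition) and Thm. 2.3] -/
theorem fixedForms_slSubgroup_perPoly_eq_of_charZero (F : Type*) [Field F] [CharZero F]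
    (hn : n % 4 ≠ 1) :
    fixedForms (slSubgroup (Fin n × Fin n) F) (perPoly (Fin n) F) n = F ∙ perPoly (Fin n) F :=
  (isCharacterizedByStabilizerIn_slSubgroup_perPoly_of_charZero F hn).fixedForms_eq
    (by simpa using perPoly_isHomogeneous (n := Fin n) (k := F))

/-- **Over every field of characteristic `0`, the `SL(X)`-reading of "`perm_n` is characterized by
its stabilizer" holds iff `n ≢ 1 (mod 4)`** (`n ≥ 2`). (`ℂ`:
`isCharacterizedByStabilizerIn_slSubgroup_perPoly_iff`.)
[cite: MulmuleySohoniGCT2SIAM2008, §1 (definition) and Thm. 2.3 (arXiv cs/0612134 Thm. 3.3)] -/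
theorem isCharacterizedByStabilizerIn_slSubgroup_perPoly_iff_of_charZero (F : Type*) [Field F]
    [CharZero F] (h2 : 2 ≤ n) :
    IsCharacterizedByStabilizerIn (slSubgroup (Fin n × Fin n) F) (perPoly (Fin n) F) n ↔
      n % 4 ≠ 1 :=
  ⟨fun h h1 => not_isCharacterizedByStabilizerIn_slSubgroup_perPoly_of_charZero F (by omega) h1 h,
    isCharacterizedByStabilizerIn_slSubgroup_perPoly_of_charZero F⟩

/-! ## The determinant and the padded permanent over `F` -/

/-- `W^{SL_{m²}(F) ∩ Stab(det_m)} = F · det_m`, every `m`, every field `F` of characteristic `0`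
(GCT II Thm. 2.3 for `det(Y)`, literal `G = SL(Y)` reading = GCT I Prop. 4.2 in characteristic `0`:
the tree's `MS2001_prop_4_2_of_charZero`, `MS2001ClassVarieties.lean`).
[cite: MulmuleySohoniGCT2SIAM2008, §1 (definition) and Thm. 2.3]
[cite: MulmuleySohoniSIAM2001, Prop. 4.2 (AV p.13)] -/
theorem fixedForms_slSubgroup_detPoly_eq_of_charZero (F : Type*) [Field F] [CharZero F] (m : ℕ) :
    fixedForms (slSubgroup (Fin m × Fin m) F) (detPoly (Fin m) F) m = F ∙ detPoly (Fin m) F :=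
  (MS2001_prop_4_2_of_charZero F m).fixedForms_eq
    (by simpa using detPoly_isHomogeneous (n := Fin m) (k := F))

/-- **The padded permanent `X₀₀^{m−n} per_n` is characterized by its stabilizer in `SL_{m²}(F)`**
(`n < m`, `m ≥ 3`, characteristic `0`): restatement for `slSubgroup` of
`CharacterizedByStabilizer.paddedPerPoly_eq_smul_of_fixed_of_det_eq_one`.
[cite: MulmuleySohoniGCT2SIAM2008, §1 (definition) and Thm. 2.3 (arXiv cs/0612134 Thm. 3.3)]
[cite: MulmuleySohoniGCTIntro2007, Lecture 13, Prop. [GCT1](3)] -/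
theorem isCharacterizedByStabilizerIn_slSubgroup_paddedPerPoly_of_charZero (F : Type*) [Field F]
    [CharZero F] {n m : ℕ} [NeZero m] (hnm : n < m) (hm : 3 ≤ m) :
    IsCharacterizedByStabilizerIn (slSubgroup (Fin m × Fin m) F) (paddedPerPoly F n m) m :=
  fun p hp hfix => CharacterizedByStabilizer.paddedPerPoly_eq_smul_of_fixed_of_det_eq_one hnm hm p hp
    fun γ hdet hpad => hfix γ (mem_slSubgroup_iff.mpr hdet) hpad

/-- `V^{SL_{m²}(F) ∩ Stab(X₀₀^{m−n} per_n)} = F · X₀₀^{m−n} per_n` for `n < m`, `m ≥ 3`, characteristic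
`0`. [cite: MulmuleySohoniGCT2SIAM2008, §1 (definition) and Thm. 2.3] -/
theorem fixedForms_slSubgroup_paddedPerPoly_eq_of_charZero (F : Type*) [Field F] [CharZero F]
    {n m : ℕ} [NeZero m] (hnm : n < m) (hm : 3 ≤ m) :
    fixedForms (slSubgroup (Fin m × Fin m) F) (paddedPerPoly F n m) m = F ∙ paddedPerPoly F n m :=
  (isCharacterizedByStabilizerIn_slSubgroup_paddedPerPoly_of_charZero F hnm hm).fixedForms_eq
    (paddedPerPoly_isHomogeneous (le_of_lt hnm))

/-! ## GCT I Example 5.2.1 with `W = Sym^d(X)` (`a = 1`) over `F` -/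

/-- **`dim (Sym^d)^Q = 1`** for `Q = SL_{d²}(F) ∩ Stab(det_d)`, every `d`, every field of
characteristic `0` (the `a = 1` line of the `det`-side of GCT I Example 5.2.1).
[cite: MulmuleySohoniSIAM2001, §5.2.1 Example 1 (AV p. 22)] [cite: MulmuleySohoniGCT2SIAM2008, Thm. 2.3] -/
theorem finrank_fixedForms_slSubgroup_detPoly_self_of_charZero (F : Type*) [Field F] [CharZero F]
    (d : ℕ) :
    Module.finrank F (fixedForms (slSubgroup (Fin d × Fin d) F) (detPoly (Fin d) F) d) = 1 := by
  rw [fixedForms_slSubgroup_detPoly_eq_of_charZero F d]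
  exact finrank_span_singleton (detPoly_ne_zero' d F)

/-- **`dim (Sym^d)^H = 1`** for `H = SL_{d²}(F) ∩ Stab(per_d)`, `d ≢ 1 (mod 4)`, characteristic `0`.
[cite: MulmuleySohoniSIAM2001, §5.2.1 Example 1 (AV p. 22)] [cite: MulmuleySohoniGCT2SIAM2008, Thm. 2.3] -/
theorem finrank_fixedForms_slSubgroup_perPoly_self_of_mod_four_ne_one_of_charZero (F : Type*)
    [Field F] [CharZero F] {d : ℕ} (hd : d % 4 ≠ 1) :
    Module.finrank F (fixedForms (slSubgroup (Fin d × Fin d) F) (perPoly (Fin d) F) d) = 1 := by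
  rw [fixedForms_slSubgroup_perPoly_eq_of_charZero F hd]
  exact finrank_span_singleton (perPoly_ne_zero' d F)

/-- **`dim (Sym^d)^H ≥ 2`** for `H = SL_{d²}(F) ∩ Stab(per_d)`, `d ≡ 1 (mod 4)`, `d ≥ 5`,
characteristic `0` (`per_d`, `det_d ∈ (Sym^d)^H`).
[cite: MarcusMay1962, §2 Theorem, p. 179] [cite: MulmuleySohoniSIAM2001, §5.2.1 Example 1 (AV p. 22)] -/
theorem two_le_finrank_fixedForms_slSubgroup_perPoly_self_of_mod_four_eq_one_of_charZero
    (F : Type*) [Field F] [CharZero F] {d : ℕ} (h5 : 5 ≤ d) (h1 : d % 4 = 1) :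
    2 ≤ Module.finrank F (fixedForms (slSubgroup (Fin d × Fin d) F) (perPoly (Fin d) F) d) := by
  have hli := linearIndependent_perPoly_detPoly' (F := F) (d := d) (by omega)
  haveI : Module.Finite F ↥(homogeneousSubmodule (Fin d × Fin d) F d) :=
    finite_homogeneousSubmodule' _ F _
  haveI : Module.Finite F
      ↥(fixedForms (slSubgroup (Fin d × Fin d) F) (perPoly (Fin d) F) d) :=
    Submodule.finiteDimensional_of_le (fun p hp => hp.1)
  have hle : Submodule.span F (Set.range ![perPoly (Fin d) F, detPoly (Fin d) F]) ≤
      fixedForms (slSubgroup (Fin d × Fin d) F) (perPoly (Fin d) F) d := by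
    rw [Submodule.span_le]
    rintro _ ⟨i, rfl⟩
    fin_cases i
    · have hper : perPoly (Fin d) F ∈
          fixedForms (slSubgroup (Fin d × Fin d) F) (perPoly (Fin d) F) d :=
        mem_fixedForms_iff.mpr
          ⟨by simpa using perPoly_isHomogeneous (n := Fin d) (k := F), fun _ _ h => h⟩
      simpa using hper
    · simpa using detPoly_mem_fixedForms_slSubgroup_perPoly_of_charZero F (by omega) h1
  calc 2 = Module.finrank F (Submodule.span F
      (Set.range ![perPoly (Fin d) F, detPoly (Fin d) F])) := by
        rw [finrank_span_eq_card hli]; simp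
    _ ≤ _ := Submodule.finrank_mono hle

/-- **GCT I Example 5.2.1 in degree `d` over every field of characteristic `0`:** for `d ≥ 2`,
`dim (Sym^d)^{SL ∩ Stab det_d} < dim (Sym^d)^{SL ∩ Stab per_d} ↔ d ≡ 1 (mod 4)` — the multiplicity
hypothesis of GCT I Thm. 5.1 for `(per_d, det_d)` with `W = Sym^d(X)` (`a = 1`) holds exactly in the
residue `d ≡ 1 (mod 4)` (MS's obstructions are `Sym^{ad}`, `a > 1`). (`ℂ`:
`MS2001_example_5_2_1_degree_self_iff`.) Own computation on the printed example.
[cite: MulmuleySohoniSIAM2001, §5.2.1 Example 1 (AV pp. 21–22)] [cite: MarcusMay1962, §2 Theorem, p. 179] -/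
theorem MS2001_example_5_2_1_degree_self_iff_of_charZero (F : Type*) [Field F] [CharZero F]
    {d : ℕ} (h2 : 2 ≤ d) :
    Module.finrank F (fixedForms (slSubgroup (Fin d × Fin d) F) (detPoly (Fin d) F) d) <
      Module.finrank F (fixedForms (slSubgroup (Fin d × Fin d) F) (perPoly (Fin d) F) d) ↔
      d % 4 = 1 := by
  rw [finrank_fixedForms_slSubgroup_detPoly_self_of_charZero F d]
  constructor
  · intro h
    by_contra h1
    rw [finrank_fixedForms_slSubgroup_perPoly_self_of_mod_four_ne_one_of_charZero F h1] at h
    exact lt_irrefl _ h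
  · intro h1
    have h5 : 5 ≤ d := by omega
    exact lt_of_lt_of_le one_lt_two
      (two_le_finrank_fixedForms_slSubgroup_perPoly_self_of_mod_four_eq_one_of_charZero F h5 h1)

end Literature.Computability.AlgebraicComplexity

end
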